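import Summits.QuantumFields.BalabanUV.Gaps.ProfileLegComposition
import Summits.QuantumFields.BalabanUV.Beta.D1BFx.GhostLegProfilesRight

/-!
# `BalabanUV.Beta.D1BFx.GhostCompositeLegProfiles` — road «BF-x» for binder row D1, slot (K), GHOST-N8-SPEC v0.2 §3″ FILE F3 (instance half, PART 2):
# **THE FOUR COMPOSITE GHOST LEGS `S∘G`, `G∘S`, `G∘(S∘G)`, `G∘G` OF A FLAT LEG `S` AND A SINGULAR LEG `G` ON `ℤ⁴` — VALUE AND RIGHT-DIFFERENCE
# PROFILES** in FILE F1's shapes, by gaps-g1-p1's `ProfileLegComposition` (C1)∕(C2)∕(C3)∕(C4) BY NAME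

HONEST DEPENDENCY (cell records, verbatim): «continuum YM on T⁴ ⇐ BetaPertH ∧ nine spine estimates (0/9 proved); BetaPertH ⇐ (D1) ∧ (D4) ∧
CAP+tail; G-an2-4 gates asym, D1 and NE2/3/4.»  HONEST FRAMING (cell contract, verbatim): «discharging `BetaPertH` makes Bałaban's UV stability
UNCONDITIONAL — a real constructive-QFT result; it is NOT the continuum limit and NOT the Clay problem.»  THIS MODULE DISCHARGES NOTHING of the
wall: [folklore] composition BY NAME of gaps-g1-p1 GEN 6's `Gaps/ProfileLegComposition` (one singular centre at scale `n`, super-critical HLS, right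
differences commute, the one-power trade) for two ARBITRARY kernels `S`, `G : MKer 4 Unit` whose letters are DISPLAYED hypotheses (`S` flat: value `κS`,
right difference `κS′`; `G` singular: value `κG∕nrm²`, right difference `κG′∕nrm³`; common rate `δ∕n`).  No definition, no `def … : Prop`, nothing cited,
0 sorry.  0 root-level binders of row D1 discharged (hW ∕ hR-sockets ∕ hSX-socket ∕ D1Tel ∕ D1Rep = 0); (K) NOT closed; NOT D1, NOT `BetaPertH`,
NOT continuum, NOT Clay.

ABSOLUTE RULE (cell charter, verbatim): «No internally-minted statement may enter as a cited fact. Every hypothesis is either kernel-proved in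
this package or a verbatim quotation of a PUBLISHED theorem with page reference. The manuscript(s) under audit are NOT citable for their own
disputed steps — they are the thing under adjudication; programme-internal (2001/route/tribunal) claims are never citable.»

WHY (GHOST-N8-SPEC v0.2 §3″ (O5); journal N-1 [D1LEAF04-G26-N1], INTENT-5).  At `S := Pgt n a` (PART 1 §2: `κS ≍ n⁻⁴`, `κS′ ≍ n⁻⁵`) and `G := Ggh n a`
(PART 1 §1: `κG = κG′ = C∕n²`) these are the legs `P∘G`, `G∘P`, `G∘(P∘G)`, `G∘G` of the twelve ghost rest words (`RestKernelGhostWords.ghostWord`), and the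
readings of (O5) follow: `S∘G`, `G∘S`, `G∘(S∘G)` flat with value `≍ n⁻⁴` and right difference `≍ n⁻⁵`; `G∘G` of exponent `1` with value `≍ n⁻³`, right
difference `≍ n⁻⁴`.  Every output is in the `hL`∕`hdL` shape of F1 `GhostVertexOrientation.abs_comp_gW_le`.

CONTENT ([folklore]; `Site 4`, fibre `Unit`; `n ≥ 1`, `0 < δ`; `B₂(δ) := 1 + 216·((4∕δ)·(1 + 4∕δ))`, `B₃(δ) := 1 + 216·(1 + 4∕δ)`, `C₄ := 373248` — gaps'
`B_{4,2}`, `B_{4,3}`, `C_4`, written out).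
* §0 `flat_of_profile_zero` (drop `∕nrm^0`), `weaken_profile` (rate `δ → δ∕2`), the three constant identities.
* §1 `S∘G`: **`abs_comp_SG_le`** (value `(κS·κG·B₂(δ)·n²)∕nrm^0·e^{−(δ∕2∕n)…}`), **`abs_comp_SG_diff_right_le`** (`(κS·κG′·B₃(δ)·n)∕nrm^0·…`).
* §2 `G∘S`: **`abs_comp_GS_le`** (`(κG·κS·B₂(δ)·n²)∕nrm^0`), **`abs_comp_GS_diff_right_le`** (`(κG·κS′·B₂(δ)·n²)∕nrm^0`).
* §3 `G∘(S∘G)`: **`abs_comp_GSG_le`** (`(κG·(κSκGB₂(δ)n²)·B₂(δ∕2)·n²)∕nrm^0·e^{−(δ∕4∕n)…}`), **`abs_comp_GSG_diff_right_le`** (`(κG·(κSκG′B₃(δ)n)·B₂(δ∕2)·n²)∕nrm^0·…`).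
* §4 `G∘G`: **`abs_comp_GG_le`** (`(κG·(κG·(1 + 2n∕δ))·C₄)∕nrm^1·e^{−(δ∕2∕n)…}`), **`abs_comp_GG_diff_right_le`** (`(κG·κG′·C₄)∕nrm^1·e^{−(δ∕n)…}`, n-FREE).
NOT HERE (honest): the instances at `Pgt`, `Ggh` (F5 plugs PART 1), left differences (not needed by F1's right-end orientation), the rows; anything of the END.
Unit `b2b-balaban-beta-d1-formalise-leaf-04` (gen 26), D1 formalisation swarm, road «BF-x»; INTENT-5 [D1LEAF04-G26-INTENT-5]. Not in print; no existing file touched.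
-/

noncomputable section

namespace Summit.QuantumFields.BalabanUV.Beta.D1BFx.GhostCompositeLegProfiles

open scoped BigOperators
open Finset
open Literature.MathematicalPhysics.QuantumFieldTheory.Balaban1983to89
open Literature.MathematicalPhysics.QuantumFieldTheory.Balaban1983to89.Beta
open ExpKernelCalculus (Site MKer comp)
open AffineAveraging (unitVec)
open PoissonInterior (supNorm nrm nrm_pos one_le_nrm)
open Summit.QuantumFields.BalabanUV.Gaps.ProfileLegComposition (abs_comp_le_of_profiles_super summable_and_abs_comp_le_of_profiles_singular_flat
  summable_and_abs_comp_le_of_profiles_flat_singular abs_comp_le_of_profiles_singular_flat_scale abs_comp_le_of_profiles_flat_singular_scale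
  comp_shift_sub_eq_comp_diff abs_comp_le_of_profiles_crit_trade exp_damp_mono)
open Summit.QuantumFields.BalabanUV.Beta.D1BFx.GhostLegProfilesRight (exp_rate_mono)

/-! ## §0 Tools -/

/-- [folklore] Dropping the trivial power: `κ∕nrm(x−y)^0·E = κ·E`. -/
theorem flat_of_profile_zero {K : MKer 4 Unit} {κ : ℝ} {E : Site 4 → Site 4 → ℝ}
    (h : ∀ x y (g f : Unit), |K x y g f| ≤ κ / nrm (x - y) ^ 0 * E x y) : ∀ x y (g f : Unit), |K x y g f| ≤ κ * E x y := by
  intro x y g f; have := h x y g f; rwa [pow_zero, div_one] at this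

/-- [folklore] Weakening a profile's rate by half (`0 ≤ δ`, `n ≥ 1`, `κ ≥ 0`). -/
theorem weaken_profile {n : ℕ} (hn : 1 ≤ n) {K : MKer 4 Unit} {κ δ : ℝ} {p : ℕ} (hκ : 0 ≤ κ) (hδ : 0 ≤ δ)
    (h : ∀ x y (g f : Unit), |K x y g f| ≤ κ / nrm (x - y) ^ p * Real.exp (-(δ / n) * supNorm (x - y))) :
    ∀ x y (g f : Unit), |K x y g f| ≤ κ / nrm (x - y) ^ p * Real.exp (-(δ / 2 / n) * supNorm (x - y)) := by
  intro x y g f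
  refine (h x y g f).trans (mul_le_mul_of_nonneg_left (exp_rate_mono hn (by linarith) (x - y)) ?_)
  have := nrm_pos (x - y); positivity

/-- [folklore] gaps' `B_{4,2}(δ) = 1 + 216·((4∕δ)·(1+4∕δ))`. -/
theorem B2_eq (δ : ℝ) : (1 : ℝ) + 2 * (4 : ℕ) * 3 ^ ((4 : ℕ) - 1) * ((((4 : ℕ) - 1 - 2).factorial : ℕ) * (4 / δ) ^ ((4 : ℕ) - 1 - 2) * (1 + 4 / δ))
    = 1 + 216 * (4 / δ * (1 + 4 / δ)) := by
  norm_num [Nat.factorial]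

/-- [folklore] gaps' `B_{4,3}(δ) = 1 + 216·(1+4∕δ)`. -/
theorem B3_eq (δ : ℝ) : (1 : ℝ) + 2 * (4 : ℕ) * 3 ^ ((4 : ℕ) - 1) * ((((4 : ℕ) - 1 - 3).factorial : ℕ) * (4 / δ) ^ ((4 : ℕ) - 1 - 3) * (1 + 4 / δ))
    = 1 + 216 * (1 + 4 / δ) := by
  norm_num [Nat.factorial]

/-- [folklore] gaps' `C_4 = 4·2⁷·9³ = 373248`. -/
theorem C4_eq : ((4 : ℕ) : ℝ) * 2 ^ ((4 : ℕ) + 3) * 9 ^ ((4 : ℕ) - 1) = 373248 := by norm_num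

section Legs

variable {n : ℕ} (hn : 1 ≤ n) {S G : MKer 4 Unit} {κS κS' κG κG' δ : ℝ}
  (hκS : 0 ≤ κS) (hκS' : 0 ≤ κS') (hκG : 0 ≤ κG) (hκG' : 0 ≤ κG') (hδ : 0 < δ)
  (hS0 : ∀ x y (g f : Unit), |S x y g f| ≤ κS * Real.exp (-(δ / n) * supNorm (x - y)))
  (hS2 : ∀ x y (μ : Fin 4) (g f : Unit), |S x (y + unitVec μ) g f - S x y g f| ≤ κS' * Real.exp (-(δ / n) * supNorm (x - y)))
  (hG0 : ∀ x y (g f : Unit), |G x y g f| ≤ κG / nrm (x - y) ^ 2 * Real.exp (-(δ / n) * supNorm (x - y)))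
  (hG2 : ∀ x y (μ : Fin 4) (g f : Unit), |G x (y + unitVec μ) g f - G x y g f| ≤ κG' / nrm (x - y) ^ 3 * Real.exp (-(δ / n) * supNorm (x - y)))

include hn hδ

/-! ## §1 `S∘G`: flat, value `κS·κG·B₂·n²`, right difference `κS·κG′·B₃·n` -/

include hκS hκG hS0 hG0 in
/-- [folklore] **`S∘G` IS FLAT**: `|comp S G x z| ≤ (κS·κG·B₂(δ)·n²)∕nrm(x−z)^0·e^{−(δ∕2∕n)‖x−z‖∞}` ((C1′) at scale, `b = 2`). -/
theorem abs_comp_SG_le (x z : Site 4) (g f : Unit) :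
    |comp S G x z g f| ≤ (κS * κG * (1 + 216 * (4 / δ * (1 + 4 / δ))) * (n : ℝ) ^ 2) / nrm (x - z) ^ 0
      * Real.exp (-(δ / 2 / n) * supNorm (x - z)) := by
  have h := abs_comp_le_of_profiles_flat_singular_scale (d := 4) (F := Unit) (by norm_num) (b := 2) (by norm_num) hδ hn hκS hκG hS0 hG0 x z g f
  refine h.trans (le_of_eq ?_)
  rw [B2_eq]; simp

include hκS hκG hκG' hS0 hG0 hG2 in
/-- [folklore] **`S∘G`'s RIGHT DIFFERENCE**: `|comp S G x (z+e_μ) − comp S G x z| ≤ (κS·κG′·B₃(δ)·n)∕nrm(x−z)^0·e^{−(δ∕2∕n)‖x−z‖∞}` ((C3) then (C1′) at `b = 3`). -/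
theorem abs_comp_SG_diff_right_le (x z : Site 4) (μ : Fin 4) (g f : Unit) :
    |comp S G x (z + unitVec μ) g f - comp S G x z g f| ≤ (κS * κG' * (1 + 216 * (1 + 4 / δ)) * (n : ℝ) ^ 1) / nrm (x - z) ^ 0
      * Real.exp (-(δ / 2 / n) * supNorm (x - z)) := by
  have hn0 : (0 : ℝ) < n := by exact_mod_cast hn
  have hε : 0 < δ / n := by positivity
  -- the two middle sums converge (flat × singular at `z + e` and at `z`; `G`'s value letter)
  have hG0' : ∀ y w (h k : Unit), |G y w h k| ≤ κG / nrm (y - w) ^ 2 * Real.exp (-(δ / n) * supNorm (y - w)) := hG0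
  have h₁ := (summable_and_abs_comp_le_of_profiles_flat_singular (d := 4) (F := Unit) (by norm_num) (b := 2) (by norm_num) hκS hκG hε hS0 hG0'
    x (z + unitVec μ) g f).1
  have h₂ := (summable_and_abs_comp_le_of_profiles_flat_singular (d := 4) (F := Unit) (by norm_num) (b := 2) (by norm_num) hκS hκG hε hS0 hG0'
    x z g f).1
  rw [comp_shift_sub_eq_comp_diff h₁ h₂]
  have hD : ∀ y w (h k : Unit), |(fun y w (h k : Unit) => G y (w + unitVec μ) h k - G y w h k) y w h k|
      ≤ κG' / nrm (y - w) ^ 3 * Real.exp (-(δ / n) * supNorm (y - w)) := fun y w h k => hG2 y w μ h k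
  have h := abs_comp_le_of_profiles_flat_singular_scale (d := 4) (F := Unit) (by norm_num) (b := 3) (by norm_num) hδ hn hκS hκG' hS0 hD x z g f
  refine h.trans (le_of_eq ?_)
  rw [B3_eq]; simp

/-! ## §2 `G∘S`: flat, value `κG·κS·B₂·n²`, right difference `κG·κS′·B₂·n²` -/

include hκS hκG hS0 hG0 in
/-- [folklore] **`G∘S` IS FLAT**: `|comp G S x z| ≤ (κG·κS·B₂(δ)·n²)∕nrm(x−z)^0·e^{−(δ∕2∕n)‖x−z‖∞}` ((C1) at scale, `a = 2`). -/
theorem abs_comp_GS_le (x z : Site 4) (g f : Unit) :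
    |comp G S x z g f| ≤ (κG * κS * (1 + 216 * (4 / δ * (1 + 4 / δ))) * (n : ℝ) ^ 2) / nrm (x - z) ^ 0
      * Real.exp (-(δ / 2 / n) * supNorm (x - z)) := by
  have hS0' : ∀ y w (h k : Unit), |S y w h k| ≤ κS * Real.exp (-(δ / n) * supNorm (y - w)) := hS0
  have h := abs_comp_le_of_profiles_singular_flat_scale (d := 4) (F := Unit) (by norm_num) (a := 2) (by norm_num) hδ hn hκG hκS hG0 hS0' x z g f
  refine h.trans (le_of_eq ?_)
  rw [B2_eq]; simp

include hκS hκS' hκG hS0 hS2 hG0 in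
/-- [folklore] **`G∘S`'s RIGHT DIFFERENCE**: `|comp G S x (z+e_μ) − comp G S x z| ≤ (κG·κS′·B₂(δ)·n²)∕nrm(x−z)^0·e^{−(δ∕2∕n)‖x−z‖∞}`. -/
theorem abs_comp_GS_diff_right_le (x z : Site 4) (μ : Fin 4) (g f : Unit) :
    |comp G S x (z + unitVec μ) g f - comp G S x z g f| ≤ (κG * κS' * (1 + 216 * (4 / δ * (1 + 4 / δ))) * (n : ℝ) ^ 2) / nrm (x - z) ^ 0
      * Real.exp (-(δ / 2 / n) * supNorm (x - z)) := by
  have hn0 : (0 : ℝ) < n := by exact_mod_cast hn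
  have hε : 0 < δ / n := by positivity
  have hS0' : ∀ y w (h k : Unit), |S y w h k| ≤ κS * Real.exp (-(δ / n) * supNorm (y - w)) := hS0
  have h₁ := (summable_and_abs_comp_le_of_profiles_singular_flat (d := 4) (F := Unit) (by norm_num) (a := 2) (by norm_num) hκG hκS hε hG0 hS0'
    x (z + unitVec μ) g f).1
  have h₂ := (summable_and_abs_comp_le_of_profiles_singular_flat (d := 4) (F := Unit) (by norm_num) (a := 2) (by norm_num) hκG hκS hε hG0 hS0'
    x z g f).1
  rw [comp_shift_sub_eq_comp_diff h₁ h₂]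
  have hD : ∀ y w (h k : Unit), |(fun y w (h k : Unit) => S y (w + unitVec μ) h k - S y w h k) y w h k|
      ≤ κS' * Real.exp (-(δ / n) * supNorm (y - w)) := fun y w h k => hS2 y w μ h k
  have h := abs_comp_le_of_profiles_singular_flat_scale (d := 4) (F := Unit) (by norm_num) (a := 2) (by norm_num) hδ hn hκG hκS' hG0 hD x z g f
  refine h.trans (le_of_eq ?_)
  rw [B2_eq]; simp

/-! ## §3 `G∘(S∘G)`: flat, one more scale sum -/

include hκS hκG hS0 hG0 in
/-- [folklore] **`G∘(S∘G)` IS FLAT**: `|comp G (comp S G) x z| ≤ (κG·(κS·κG·B₂(δ)·n²)·B₂(δ∕2)·n²)∕nrm(x−z)^0·e^{−(δ∕4∕n)‖x−z‖∞}` (§1 at rate `δ∕2`, then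
(C1) at scale with `δ∕2`). -/
theorem abs_comp_GSG_le (x z : Site 4) (g f : Unit) :
    |comp G (comp S G) x z g f|
      ≤ (κG * (κS * κG * (1 + 216 * (4 / δ * (1 + 4 / δ))) * (n : ℝ) ^ 2) * (1 + 216 * (4 / (δ / 2) * (1 + 4 / (δ / 2)))) * (n : ℝ) ^ 2)
          / nrm (x - z) ^ 0 * Real.exp (-(δ / 4 / n) * supNorm (x - z)) := by
  have hn0 : (0 : ℝ) < n := by exact_mod_cast hn
  -- inner flat leg at rate `δ∕2`
  have hSG : ∀ y w (h k : Unit), |comp S G y w h k| ≤ (κS * κG * (1 + 216 * (4 / δ * (1 + 4 / δ))) * (n : ℝ) ^ 2)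
      * Real.exp (-(δ / 2 / n) * supNorm (y - w)) :=
    flat_of_profile_zero (fun y w h k => abs_comp_SG_le hn hκS hκG hδ hS0 hG0 y w h k)
  -- `G` at rate `δ∕2`
  have hG0' := weaken_profile hn hκG hδ.le hG0
  have hK : 0 ≤ κS * κG * (1 + 216 * (4 / δ * (1 + 4 / δ))) * (n : ℝ) ^ 2 := by positivity
  have h := abs_comp_le_of_profiles_singular_flat_scale (d := 4) (F := Unit) (by norm_num) (a := 2) (by norm_num) (half_pos hδ) hn hκG hK hG0' hSG
    x z g f
  refine h.trans (le_of_eq ?_)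
  rw [B2_eq, show δ / 2 / 2 / (n : ℝ) = δ / 4 / n by ring]; simp

include hκS hκG hκG' hS0 hG0 hG2 in
/-- [folklore] **`G∘(S∘G)`'s RIGHT DIFFERENCE**: `|comp G (comp S G) x (z+e_μ) − comp G (comp S G) x z| ≤
(κG·(κS·κG′·B₃(δ)·n)·B₂(δ∕2)·n²)∕nrm(x−z)^0·e^{−(δ∕4∕n)‖x−z‖∞}` ((C3) on the outer composition, §1's difference letter inside). -/
theorem abs_comp_GSG_diff_right_le (x z : Site 4) (μ : Fin 4) (g f : Unit) :
    |comp G (comp S G) x (z + unitVec μ) g f - comp G (comp S G) x z g f|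
      ≤ (κG * (κS * κG' * (1 + 216 * (1 + 4 / δ)) * (n : ℝ) ^ 1) * (1 + 216 * (4 / (δ / 2) * (1 + 4 / (δ / 2)))) * (n : ℝ) ^ 2)
          / nrm (x - z) ^ 0 * Real.exp (-(δ / 4 / n) * supNorm (x - z)) := by
  have hn0 : (0 : ℝ) < n := by exact_mod_cast hn
  have hε : 0 < δ / 2 / n := by positivity
  have hSG : ∀ y w (h k : Unit), |comp S G y w h k| ≤ (κS * κG * (1 + 216 * (4 / δ * (1 + 4 / δ))) * (n : ℝ) ^ 2)
      * Real.exp (-(δ / 2 / n) * supNorm (y - w)) :=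
    flat_of_profile_zero (fun y w h k => abs_comp_SG_le hn hκS hκG hδ hS0 hG0 y w h k)
  have hG0' := weaken_profile hn hκG hδ.le hG0
  have hK : 0 ≤ κS * κG * (1 + 216 * (4 / δ * (1 + 4 / δ))) * (n : ℝ) ^ 2 := by positivity
  have h₁ := (summable_and_abs_comp_le_of_profiles_singular_flat (d := 4) (F := Unit) (by norm_num) (a := 2) (by norm_num) hκG hK hε hG0' hSG
    x (z + unitVec μ) g f).1
  have h₂ := (summable_and_abs_comp_le_of_profiles_singular_flat (d := 4) (F := Unit) (by norm_num) (a := 2) (by norm_num) hκG hK hε hG0' hSG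
    x z g f).1
  rw [comp_shift_sub_eq_comp_diff h₁ h₂]
  -- the inner difference kernel is flat at rate `δ∕2` (§1)
  have hD : ∀ y w (h k : Unit), |(fun y w (h k : Unit) => comp S G y (w + unitVec μ) h k - comp S G y w h k) y w h k|
      ≤ (κS * κG' * (1 + 216 * (1 + 4 / δ)) * (n : ℝ) ^ 1) * Real.exp (-(δ / 2 / n) * supNorm (y - w)) :=
    flat_of_profile_zero (fun y w h k => abs_comp_SG_diff_right_le hn hκS hκG hκG' hδ hS0 hG0 hG2 y w μ h k)
  have hK' : 0 ≤ κS * κG' * (1 + 216 * (1 + 4 / δ)) * (n : ℝ) ^ 1 := by positivity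
  have h := abs_comp_le_of_profiles_singular_flat_scale (d := 4) (F := Unit) (by norm_num) (a := 2) (by norm_num) (half_pos hδ) hn hκG hK' hG0' hD
    x z g f
  refine h.trans (le_of_eq ?_)
  rw [B2_eq, show δ / 2 / 2 / (n : ℝ) = δ / 4 / n by ring]; simp

/-! ## §4 `G∘G`: exponent `1` -/

include hκG hG0 in
/-- [folklore] **`G∘G` HAS EXPONENT `1` AND COSTS ONE POWER OF `n`** ((C4) at `d = 4`, `a = b = 2`, `ε = δ∕n`):
`|comp G G x z| ≤ (κG·(κG·(1 + 2∕(δ∕n)))·C₄)∕nrm(x−z)^1·e^{−(δ∕2∕n)‖x−z‖∞}`. -/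
theorem abs_comp_GG_le (x z : Site 4) (g f : Unit) :
    |comp G G x z g f| ≤ (κG * (κG * (1 + 2 / (δ / n))) * 373248) / nrm (x - z) ^ 1 * Real.exp (-(δ / 2 / n) * supNorm (x - z)) := by
  have hn0 : (0 : ℝ) < n := by exact_mod_cast hn
  have hε : 0 < δ / n := by positivity
  have hG0' : ∀ y w (h k : Unit), |G y w h k| ≤ κG / nrm (y - w) ^ 2 * Real.exp (-(δ / n) * supNorm (y - w)) := hG0
  have h := abs_comp_le_of_profiles_crit_trade (d := 4) (F := Unit) (by norm_num) (a := 2) (b := 2) (by norm_num) (by norm_num) (by norm_num)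
    hκG hκG hε hG0 hG0' x z g f
  refine h.trans (le_of_eq ?_)
  rw [C4_eq, show δ / (n : ℝ) / 2 = δ / 2 / n by ring]; simp

include hκG hκG' hG0 hG2 in
/-- [folklore] **`G∘G`'s RIGHT DIFFERENCE IS SUPER-CRITICAL, n-FREE** ((C3) then (C2) at `a = 2`, `b = 3`):
`|comp G G x (z+e_μ) − comp G G x z| ≤ (κG·κG′·C₄)∕nrm(x−z)^1·e^{−(δ∕n)‖x−z‖∞}`. -/
theorem abs_comp_GG_diff_right_le (x z : Site 4) (μ : Fin 4) (g f : Unit) :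
    |comp G G x (z + unitVec μ) g f - comp G G x z g f| ≤ (κG * κG' * 373248) / nrm (x - z) ^ 1 * Real.exp (-(δ / n) * supNorm (x - z)) := by
  have hn0 : (0 : ℝ) < n := by exact_mod_cast hn
  have hε : 0 ≤ δ / n := by positivity
  have hG0' : ∀ y w (h k : Unit), |G y w h k| ≤ κG / nrm (y - w) ^ 2 * Real.exp (-(δ / n) * supNorm (y - w)) := hG0
  -- middle-sum summabilities from the critical-trade data (weaken-and-trade is inside (C4)); use (C1)-type flat majorant instead: `G` is flat with `κG`
  have hGflat : ∀ y w (h k : Unit), |G y w h k| ≤ κG * Real.exp (-(δ / n) * supNorm (y - w)) := by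
    intro y w h k
    refine (hG0 y w h k).trans ?_
    have hq := one_le_nrm (y - w)
    have h1 : κG / nrm (y - w) ^ 2 ≤ κG := div_le_self hκG (one_le_pow₀ hq)
    exact mul_le_mul_of_nonneg_right h1 (Real.exp_pos _).le
  have h₁ := (summable_and_abs_comp_le_of_profiles_singular_flat (d := 4) (F := Unit) (by norm_num) (a := 2) (by norm_num) hκG hκG
    (by positivity : 0 < δ / n) hG0 hGflat x (z + unitVec μ) g f).1
  have h₂ := (summable_and_abs_comp_le_of_profiles_singular_flat (d := 4) (F := Unit) (by norm_num) (a := 2) (by norm_num) hκG hκG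
    (by positivity : 0 < δ / n) hG0 hGflat x z g f).1
  rw [comp_shift_sub_eq_comp_diff h₁ h₂]
  have hD : ∀ y w (h k : Unit), |(fun y w (h k : Unit) => G y (w + unitVec μ) h k - G y w h k) y w h k|
      ≤ κG' / nrm (y - w) ^ 3 * Real.exp (-(δ / n) * supNorm (y - w)) := fun y w h k => hG2 y w μ h k
  have h := abs_comp_le_of_profiles_super (d := 4) (F := Unit) (by norm_num) (a := 2) (b := 3) (by norm_num) (by norm_num) (by norm_num)
    hκG hκG' hε hG0 hD x z g f
  refine h.trans (le_of_eq ?_)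
  rw [C4_eq]; simp

end Legs

end Summit.QuantumFields.BalabanUV.Beta.D1BFx.GhostCompositeLegProfiles

end
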